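import Literature.NumberTheory.Automorphic.AutomorphicSpectrum
import HarnessLib

/-!
# Hecke eigenvectors from one-dimensional fixed spaces (proof)

Trunk `AutomorphicAxiomatic` (G19), topic `NumberTheory/Automorphic`; sibling proof file of
`AutomorphicSpectrum` (theorems only, no definition, no named fact), discharging its named fact
`Literature.NumberTheory.Automorphic.exists_isHeckeEigenvector_of_finrank_fixedVectors_eq_one`:

*for an adelic group datum `𝒢` over a number field `K`, an automorphic measure `μ` on
`G(𝔸_K) ⧸ (A_G · G(K))`, a compact open subgroup `Kf ≤ G(𝔸_K)` and a closed subrepresentation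
`W` of `L²(G(𝔸_K) ⧸ A_G G(K), μ)` whose `Kf`-fixed vectors `W^{Kf}` form a line, `W` contains a
Hecke eigenvector of level `Kf`* (`exists_isHeckeEigenvector_of_finrank_fixedVectors_eq_one_holds`;
Borel–Jacquet, Corvallis (1979), §4.6).

The proof is the one printed in Bump (1997), §4.6, Eq. (6.1) ("`π(φ) v_K` is also spherical, so
`π(φ) v_K = ξ(φ) v_K`"): a compact open `Kf` makes `(Kf, G(𝔸_K), Kf)` a Hecke pair
(`isHeckeTriple_top_of_isCompact_isOpen` of `HeckeAlgebra`), so each double coset `Kf g Kf` is a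
finite union of left cosets (`finite_orbit_quotient`) and the Hecke operator `[Kf g Kf]` maps
`W^{Kf}` to itself (`heckeOperator_apply_mem_fixedPoints`); on the line `W^{Kf} = ℂ f₀` it
therefore acts by a scalar, `[Kf g Kf] f₀ = ev g • f₀`, and `f₀ ≠ 0` is the eigenvector.

Nothing in `AutomorphicSpectrum` is restated or modified; consumers holding
`(h : exists_isHeckeEigenvector_of_finrank_fixedVectors_eq_one)` are fed
`exists_isHeckeEigenvector_of_finrank_fixedVectors_eq_one_holds`. The other named fact of that
file with a proof, `isStronglyContinuous_rightRegular`, is discharged in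
`AutomorphicSpectrumProofs`.

## References

* A. Borel, H. Jacquet, *Automorphic forms and automorphic representations*, Proc. Sympos.
  Pure Math. 33 (Corvallis 1979), Part 1, §4.6 [BorelJacquetCorvallis1979].
* D. Bump, *Automorphic forms and representations*, Cambridge Stud. Adv. Math. 55 (1997), §4.6,
  Eq. (6.1) [Bump1997].
* G. Shimura, *Introduction to the arithmetic theory of automorphic functions* (1971), Ch. 3.
-/

noncomputable section

open MeasureTheory

namespace Literature.NumberTheory.Automorphic

universe u

variable {K : Type} [Field K] [NumberField K] {𝒢 : AdelicGroupData.{u} K}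
  {μ : Measure 𝒢.automorphicQuotient} [𝒢.IsAutomorphicMeasure μ]

/-- **Hecke eigenvectors from one-dimensional fixed spaces**: the named fact
`exists_isHeckeEigenvector_of_finrank_fixedVectors_eq_one` of `AutomorphicSpectrum`, now proved
(Borel–Jacquet (1979), §4.6). For `Kf ≤ G(𝔸_K)` compact open, `(Kf, G(𝔸_K), Kf)` is a Hecke
pair (`isHeckeTriple_top_of_isCompact_isOpen`), so every `Kf g Kf / Kf` is finite
(`finite_orbit_quotient`) and each Hecke operator `[Kf g Kf]` maps `W^{Kf}` into itself
(`heckeOperator_apply_mem_fixedPoints`). If `W^{Kf}` is a line, spanned by `f₀ ≠ 0`, then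
`[Kf g Kf] f₀ ∈ W^{Kf} = ℂ f₀`, i.e. `[Kf g Kf] f₀ = ev g • f₀` for a scalar `ev g`; this is the
argument printed in Bump (1997), §4.6, Eq. (6.1) ("`π(φ) v_K` is also spherical, so
`π(φ) v_K = ξ(φ) v_K`"). [cite: BorelJacquetCorvallis1979, §4.6] -/
theorem exists_isHeckeEigenvector_of_finrank_fixedVectors_eq_one_holds :
    exists_isHeckeEigenvector_of_finrank_fixedVectors_eq_one (𝒢 := 𝒢) (μ := μ) := by
  intro W Kf hKc hKo hW
  haveI : IsHeckeTriple (⊤ : Submonoid 𝒢.Adelic) Kf Kf :=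
    isHeckeTriple_top_of_isCompact_isOpen Kf hKc hKo
  -- a generator `v` of the line `W^{Kf}`
  obtain ⟨v, hv0, hspan⟩ := finrank_eq_one_iff'.mp hW
  -- each Hecke operator `[Kf g Kf]` preserves `W^{Kf}`
  have hmem : ∀ g : 𝒢.Adelic,
      heckeOperatorAt W Kf g (v : W.toSubmodule) ∈ W.fixedVectors Kf := fun g =>
    heckeOperator_apply_mem_fixedPoints W.toContRep.toRepresentation Kf g v.2
      (finite_orbit_quotient Kf g)
  -- hence it acts on the generator by a scalar `ev g`
  choose ev hev using fun g : 𝒢.Adelic =>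
    hspan ⟨heckeOperatorAt W Kf g (v : W.toSubmodule), hmem g⟩
  refine ⟨(v : W.toSubmodule), ev, v.2, mt (Submodule.coe_eq_zero (x := v)).mp hv0, fun g => ?_⟩
  have h := congrArg Subtype.val (hev g)
  rw [Submodule.coe_smul] at h
  exact h.symm

/-- Pointwise form of `exists_isHeckeEigenvector_of_finrank_fixedVectors_eq_one_holds`: a closed
subrepresentation `W ≤ L²(G(𝔸_K) ⧸ A_G G(K), μ)` with a one-dimensional space of `Kf`-fixed
vectors, `Kf` compact open, contains a Hecke eigenvector of level `Kf` (Borel–Jacquet (1979),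
§4.6; Bump (1997), §4.6, Eq. (6.1)). [cite: BorelJacquetCorvallis1979, §4.6] -/
theorem exists_isHeckeEigenvector_of_finrank_eq_one
    (W : ContRepresentation.ClosedSubrep (𝒢.rightRegular μ)) {Kf : Subgroup 𝒢.Adelic}
    (hKc : IsCompact (Kf : Set 𝒢.Adelic)) (hKo : IsOpen (Kf : Set 𝒢.Adelic))
    (hW : Module.finrank ℂ (W.fixedVectors Kf) = 1) :
    ∃ (f : W.toSubmodule) (ev : 𝒢.Adelic → ℂ), IsHeckeEigenvector W Kf f ev :=
  exists_isHeckeEigenvector_of_finrank_fixedVectors_eq_one_holds W Kf hKc hKo hW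

/-- **Discharge of the corollary `exists_isHeckeEigenvector_of_isTopIrreducible`** of
`AutomorphicSpectrum`: a discrete automorphic representation `Π ≤ L²` with a one-dimensional
space of `Kf`-fixed vectors (`Kf` compact open) contains a Hecke eigenvector of level `Kf`; the
interim proof preserved in `AutomorphicSpectrum` (apply the previous fact to `Π.space`), now
honest (Borel–Jacquet (1979), §4.6). [cite: BorelJacquetCorvallis1979, §4.6] -/
theorem exists_isHeckeEigenvector_of_isTopIrreducible_holds :
    exists_isHeckeEigenvector_of_isTopIrreducible (𝒢 := 𝒢) (μ := μ) :=
  fun P Kf hKc hKo hP =>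
    exists_isHeckeEigenvector_of_finrank_fixedVectors_eq_one_holds P.space Kf hKc hKo hP

end Literature.NumberTheory.Automorphic
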